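import Literature.NumberTheory.EllipticCurves.SelmerPInftyGaloisAction
import Literature.NumberTheory.EllipticCurves.ArchimedeanLocalCondition
import Summits.BirchSwinnertonDyer.BirchSwinnertonDyer.Theorems.SylvesterTwoHeegnerIndexShaOmegaAction
import HarnessLib

/-!
# Route `SylvesterTwoHeegnerIndex` (rung K7t), crux `UpperOffV0HSYPlus` (item 19804): the ARITHMETIC
# WRAPPER, brick (WRAP-σ) — complex conjugation on the TREE's `H¹(K, E)` and `Ш(E/K)` for `E/ℚ`,
# its anti-commutation `σ ∘ w = w̄ ∘ σ` with the `ℤ[ζ₃]`-action (WRAP-𝒪), and the SQUARE LAW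

Cell `bsd-cm` (`run/shared/lean/pub/bsd-cm/`), seat `bsd-cm-k7t-c2` (prover-bsd-cm-k7t-c2-g19-0; hand
item 19229 `HeegnerIndexUpperAtTwoHSY`, verdict unchanged: NOT FOUND as a theorem), planner GO
STATUS 2026-08-28T03:56:13Z on OFFER #2 under D347 (M1)(K-ty) «VARIANT K infrastructure line»;
kernel helper `--supports stmt-BirchSwinnertonDyer-19804 --as helper`. PARTITION (D-0054): CornerF at
`p = 2` (B14/O12) × 𝒞_HSY × `p = 2` — types-the-object-of: the «`σ`» half of the data `(M, w, σ)` of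
LEMMA D ≡ LEMMA K0 (`SylvesterTwoUnramifiedDescent`), on the TREE's own
`Ш(E/K) = ker (H¹(K, E) → ∏_v H¹(K_v, E))`; with the «`w`» half (`SylvesterTwoShaOmegaAction`,
p603310) the SQUARE LAW `#Ш(E/K)[2^∞] = (#Ш(E/K)[2^∞]^σ)²` of memo two §57.1 becomes a kernel theorem
for every `j = 0` short model over `ℚ` and every totally complex `K ∋ ζ₃`. Closes no cell and no
item; BSD is not claimed; the identification `Ш^σ ↔ res Ш(E/ℚ)` (inflation–restriction, memo (L2))
is NOT claimed. Everything is PROVED: no definition, no instance, no notation, no named fact.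

## What is proved
§1 **`conjH1Points_mem_sha`** (`τ_*` = `SelmerPInftyGaloisAction.IsLiftOfAut.conjH1Points` maps the
tree's `Ш(E/K)` into itself for `E/ℚ`, `K` totally complex; twin of `conjAct_mem_selmerGroup`; complex places by the
tree's `ArchimedeanLocalCondition.localRestrictionKer_eq_top_of_isAlgClosed`);
§2 `conjH1Points_eq` / `_trans` / `_one_refl` / **`conjH1Points_conjH1Points_of_mul_self`** (lift
independence, multiplicativity, identity, involution — full-points twins of the tree's `conjH1_*`);
§3 `pointsMap_cm_eq` (`τ ∘ [ζ] = [ζ]² ∘ τ` on `E(K̄)` when `σ ζ = ζ²`) and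
**`conjH1Points_galH1Map_add`** (`τ_*(w c) + w(τ_* c) + τ_* c = 0` on `H¹(K, E)`, `w = H¹([ζ])`);
§4 **`exists_lemmaD_data`** (on `M = Ш(E/K)[2^∞]`: `w`, `s = τ_*` with `w² + w + 1 = 0`, `s² = 1`,
`s w = -s - w s`, `3` bijective = ALL hypotheses of `SylvesterTwoUnramifiedDescent.descent_bijective`)
and **`card_sha_two_primary_eq_card_invariants_sq`** (SQUARE LAW `Nat.card M = (Nat.card M^{s})²`).

## What is NOT here (the (K-ty) residue named in the GO line)
Model transport to arbitrary minimal models of `E_p` / `E_{3p²}`; the identification of `M^{s}` /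
`M^{s = -1}` with the ℚ-objects of the pair (inflation–restriction up to LEMMA D's `2`-torsion
error); the `p = 2` Kolyvagin-class vocabulary in the CM frame. Item words of 19229/19804 unchanged.

## References
Gross, LMS LNS 153 (1991) §5 (5.1), §6 [GrossLMS1991]; Cassels–Fröhlich, Ch. VII (Tate) §1.1
[CasselsFrohlichANT1967]; Serre, *Local Fields* VII.§5 Prop. 3 [SerreLocalFields1979]; Silverman,
*AEC* (2009) Thm. III.10.1, Cor. III.10.2 [SilvermanAEC2009]; Milne, *ADT* I.§6 [MilneADT2006];
cell: memo two v2.21 §57.1 (LEMMA K0), HANDOFF § k7t-c2 g16 «(WRAP-σ)», planner D347/D351.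
-/

set_option autoImplicit false
set_option linter.dupNamespace false

noncomputable section

open scoped Classical

open WeierstrassCurve Literature.NumberTheory.EllipticCurves
  Literature.NumberTheory.GaloisRepresentations

namespace Summit.BirchSwinnertonDyer.BirchSwinnertonDyer.Theorems.SylvesterTwoShaConjugation

/-! ## §1 `Ш(E/K)` is stable under `Aut(K/ℚ)` for `E/ℚ` and `K` totally complex -/

section Stability

open NumberField IsDedekindDomain Literature.NumberTheory.Automorphic

variable {K : Type} [Field K] [NumberField K] (W : WeierstrassCurve ℚ) {σ : K ≃ₐ[ℚ] K}
  {τ : AlgebraicClosure K ≃+* AlgebraicClosure K}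

/-- **`Ш(E/K)` is stable under `Aut(K/ℚ)`** for `E = W/ℚ` and a number field `K` all of whose
infinite places are complex: `τ_*` (`IsLiftOfAut.conjH1Points`) moves the local condition at `σ⁻¹ v`
to the one at `v` along the Galois transport of completions (`conjH1Points_mem_localRestrictionKer_iff`,
`galAdicCompletionEquiv`), and the conditions at complex places are empty (the tree's
`localRestrictionKer_eq_top_of_isAlgClosed`, `ArchimedeanLocalCondition`). Full-points twin of the
tree's `conjAct_mem_selmerGroup`. Gross 1991, §5 (5.1): `Gal(K/ℚ) = ⟨1, τ⟩` acts on `Ш(E/K)`.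
[cite: GrossLMS1991, §5 (5.1)] [cite: CasselsFrohlichANT1967, Ch. VII §1.1] -/
theorem conjH1Points_mem_sha (hK : ∀ w : InfinitePlace K, w.IsComplex) (hτ : IsLiftOfAut σ τ)
    {c : (W.baseChange K).galH1} (hc : c ∈ (W.baseChange K).sha) :
    hτ.conjH1Points W c ∈ (W.baseChange K).sha := by
  rw [WeierstrassCurve.mem_sha_iff] at hc ⊢
  refine ⟨fun v' ↦ ?_, fun w ↦ ?_⟩
  · have h : σ • (σ⁻¹ • v') = v' := smul_inv_smul σ v'
    haveI : CharZero ((σ⁻¹ • v').adicCompletion K) :=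
      charZero_of_injective_algebraMap (algebraMap K _).injective
    haveI : CharZero (v'.adicCompletion K) :=
      charZero_of_injective_algebraMap (algebraMap K _).injective
    exact (conjH1Points_mem_localRestrictionKer_iff W hτ (galAdicCompletionEquiv (L := K) σ h)
      (isSemilinearRingEquiv_galAdicCompletionEquiv σ h) c).mpr (hc.1 _)
  · haveI : IsAlgClosed w.Completion :=
      isAlgClosed_of_ringEquiv (InfinitePlace.Completion.ringEquivComplexOfIsComplex (hK w)).symm
    rw [localRestrictionKer_eq_top_of_isAlgClosed]
    trivial

end Stability

/-! ## §2 `τ_*` on `H¹(K, E)`: independence of the lift, multiplicativity, identity, involution -/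

section Lifts

variable {K : Type} [Field K] [CharZero K] (W : WeierstrassCurve ℚ)
variable {σ σ₁ σ₂ : K ≃ₐ[ℚ] K} {τ τ₁ τ₂ : AlgebraicClosure K ≃+* AlgebraicClosure K}

/-- Changing the lift by `γ = τ₂⁻¹τ₁ ∈ Γ_K` twists the coefficient side of the pair on `E(K̄)`:
`τ₁ P = τ₂ (γ P)`. [folklore] -/
theorem pointsMap_eq_comp (hτ₁ : IsLiftOfAut σ τ₁) (hτ₂ : IsLiftOfAut σ τ₂) :
    hτ₁.pointsMap W = (hτ₂.pointsMap W).comp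
      (DistribSMul.toAddMonoidHom (geomPoints (W.baseChange K)) (hτ₁.divGal hτ₂)) := by
  ext R
  change hτ₁.pointsMap W R = hτ₂.pointsMap W ((hτ₁.divGal hτ₂) • R)
  change ((W.baseChange K).baseChange (AlgebraicClosure K)).toAffine.Point at R
  rcases R with _ | ⟨x, y, h⟩
  · rfl
  · exact Affine.Point.some_eq_some_of_eq (τ₂.apply_symm_apply _).symm (τ₂.apply_symm_apply _).symm

/-- **Independence of the lift** on `H¹(K, E)` (two lifts differ by `γ ∈ Γ_K`; inner automorphisms
act trivially on `H¹`: the tree's `map_one_eq_of_conj_comp`). [cite: SerreLocalFields1979, VII.§5 Prop. 3] -/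
theorem conjH1Points_eq (hτ₁ : IsLiftOfAut σ τ₁) (hτ₂ : IsLiftOfAut σ τ₂) :
    hτ₁.conjH1Points W = hτ₂.conjH1Points W := by
  unfold IsLiftOfAut.conjH1Points resH1Hom
  rw [map_one_eq_of_conj_comp hτ₂.conjGalCMH (hτ₂.pointsMap W) (hτ₂.pointsMap_smul W)
    (hτ₁.divGal hτ₂) (hτ₁.pointsMap_smul W) (hτ₁.conjGalCMH_eq_conj_comp hτ₂)
    (pointsMap_eq_comp W hτ₁ hτ₂)]

/-- The coefficient side of the pair of a composite lift is the composite, on `E(K̄)`. [folklore] -/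
theorem pointsMap_trans (hτ₁ : IsLiftOfAut σ₁ τ₁) (hτ₂ : IsLiftOfAut σ₂ τ₂) :
    (hτ₁.trans hτ₂).pointsMap W = (hτ₂.pointsMap W).comp (hτ₁.pointsMap W) := by
  ext R
  change (hτ₁.trans hτ₂).pointsMap W R = hτ₂.pointsMap W (hτ₁.pointsMap W R)
  change ((W.baseChange K).baseChange (AlgebraicClosure K)).toAffine.Point at R
  rcases R with _ | ⟨x, y, h⟩
  · rfl
  · rfl

/-- **Multiplicativity** on `H¹(K, E)`: the lift `τ₂ ∘ τ₁` of `σ₂σ₁` acts as the composite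
(Mathlib `ContinuousCohomology.map_comp`, through the tree's `map_one_eq_comp_of_eq`). [folklore] -/
theorem conjH1Points_trans (hτ₁ : IsLiftOfAut σ₁ τ₁) (hτ₂ : IsLiftOfAut σ₂ τ₂) :
    (hτ₁.trans hτ₂).conjH1Points W = (hτ₂.conjH1Points W).comp (hτ₁.conjH1Points W) := by
  unfold IsLiftOfAut.conjH1Points resH1Hom
  rw [map_one_eq_comp_of_eq hτ₁.conjGalCMH (hτ₁.pointsMap W) (hτ₁.pointsMap_smul W)
    hτ₂.conjGalCMH (hτ₂.pointsMap W) (hτ₂.pointsMap_smul W)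
    ((hτ₁.trans hτ₂).pointsMap_smul W) (hτ₁.conjGalCMH_trans hτ₂) (pointsMap_trans W hτ₁ hτ₂)]
  rfl

/-- **Identity**: the trivial lift acts trivially on `H¹(K, E)` (Mathlib
`ContinuousCohomology.map_id`). [folklore] -/
theorem conjH1Points_one_refl :
    (isLiftOfAut_one_refl (k := ℚ) (K := K)).conjH1Points W = AddMonoidHom.id _ := by
  unfold IsLiftOfAut.conjH1Points resH1Hom
  rw [map_one_eq_id_of_eq]
  · rfl
  · apply ContinuousMonoidHom.ext
    intro g
    apply AlgEquiv.ext
    intro x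
    rfl
  · ext R
    change ((W.baseChange K).baseChange (AlgebraicClosure K)).toAffine.Point at R
    rcases R with _ | ⟨x, y, h⟩
    · rfl
    · rfl

/-- **`τ_*` is an involution on `H¹(K, E)`** for `σ² = 1`: `τ ∘ τ` lifts `σ² = 1`, so acts as the
trivial lift does (independence of the lift). [cite: GrossLMS1991, §5 (5.1)] -/
theorem conjH1Points_conjH1Points_of_mul_self (hσ : σ * σ = 1) (hτ : IsLiftOfAut σ τ)
    (x : (W.baseChange K).galH1) : hτ.conjH1Points W (hτ.conjH1Points W x) = x := by
  have key : ∀ {σ' : K ≃ₐ[ℚ] K} (h' : IsLiftOfAut σ' (τ.trans τ)), σ' = 1 →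
      h'.conjH1Points W = AddMonoidHom.id _ := by
    intro σ' h' e
    subst e
    rw [conjH1Points_eq W h' isLiftOfAut_one_refl, conjH1Points_one_refl]
  have e := key (hτ.trans hτ) hσ
  rw [conjH1Points_trans W hτ hτ] at e
  exact DFunLike.congr_fun e x

end Lifts

/-! ## §3 Anti-commutation with the complex multiplication: `τ ∘ [ζ] = [ζ̄] ∘ τ`, `[ζ̄] = -1 - [ζ]` -/

section AntiCommutation

variable {K : Type} [Field K] [CharZero K] (W : WeierstrassCurve ℚ)
variable {σ : K ≃ₐ[ℚ] K} {τ : AlgebraicClosure K ≃+* AlgebraicClosure K}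

/-- `τ_*` on a cocycle class: `τ_* [a] = [g ↦ τ a(τ⁻¹ g τ)]` (Mathlib `ContinuousCohomology.map` on
explicit cocycles, the tree's `map_oneCocycleClass`). Serre, *Galois Cohomology*, I.§2.4. [folklore] -/
theorem conjH1Points_oneCocycleClass (hτ : IsLiftOfAut σ τ)
    (a : contOneCocycles (discreteTopRep (Field.absoluteGaloisGroup K) (geomPoints (W.baseChange K)))) :
    hτ.conjH1Points W (oneCocycleClass _ a) = oneCocycleClass _
      (contOneCocycles.pullback hτ.conjGalCMH
        (resHomOfEquivariant hτ.conjGalCMH (hτ.pointsMap W) (hτ.pointsMap_smul W)) a) :=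
  map_oneCocycleClass _ _ _ a

/-- **`τ ∘ [ζ] = [ζ]² ∘ τ` on `E(K̄)`** for `E/ℚ`, `ζ ∈ K` with `σ ζ = ζ²`: for `ψ` acting by
`(x, y) ↦ (τ x, τ y)` (e.g. `IsLiftOfAut.pointsMap`) and `φ` acting by `(x, y) ↦ (ζ'²x, ζ'³y)` (the
complex multiplication), `ψ (φ P) = φ (φ (ψ P))` (`τ (ζ'²x, ζ'³y) = (ζ'⁴ τx, ζ'⁶ τy)`).
[cite: SilvermanAEC2009, Thm. III.10.1 and Cor. III.10.2] -/
theorem pointsMap_cm_eq (hτ : IsLiftOfAut σ τ) {ζ : K} (hσ : σ ζ = ζ ^ 2)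
    (ψ φ : geomPoints (W.baseChange K) →+ geomPoints (W.baseChange K))
    (hψ : ∀ (x y : AlgebraicClosure K)
      (h : ((W.baseChange K).baseChange (AlgebraicClosure K)).toAffine.Nonsingular x y),
      ∃ h', ψ (Affine.Point.some x y h) = Affine.Point.some (τ x) (τ y) h')
    (hφ : ∀ (x y : AlgebraicClosure K)
      (h : ((W.baseChange K).baseChange (AlgebraicClosure K)).toAffine.Nonsingular x y),
      ∃ h', φ (Affine.Point.some x y h) =
        Affine.Point.some (algebraMap K (AlgebraicClosure K) ζ ^ 2 * x)
          (algebraMap K (AlgebraicClosure K) ζ ^ 3 * y) h')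
    (P : geomPoints (W.baseChange K)) : ψ (φ P) = φ (φ (ψ P)) := by
  set ζ' : AlgebraicClosure K := algebraMap K (AlgebraicClosure K) ζ with hζ'
  have hτζ : τ ζ' = ζ' ^ 2 := by rw [hζ', hτ, hσ, map_pow]
  change ((W.baseChange K).baseChange (AlgebraicClosure K)).toAffine.Point at P
  rcases P with _ | ⟨x, y, h⟩
  · change ψ (φ 0) = φ (φ (ψ 0))
    simp only [map_zero]
  · obtain ⟨h₁, e₁⟩ := hφ x y h
    obtain ⟨h₂, e₂⟩ := hψ _ _ h₁
    obtain ⟨h₃, e₃⟩ := hψ x y h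
    obtain ⟨h₄, e₄⟩ := hφ _ _ h₃
    obtain ⟨h₅, e₅⟩ := hφ _ _ h₄
    change ψ (φ (Affine.Point.some x y h)) = φ (φ (ψ (Affine.Point.some x y h)))
    rw [e₁, e₂, e₃, e₄, e₅]
    refine Affine.Point.some_eq_some_of_eq ?_ ?_
    · rw [map_mul, map_pow, hτζ]; ring
    · rw [map_mul, map_pow, hτζ]; ring

/-- **`σ ∘ w = -σ - w ∘ σ` on `H¹(K, E)`** (the hypothesis `hσw` of LEMMA D, `σ w σ⁻¹ = w̄ = -1 - w`):
for `E/ℚ`, a lift `τ` of `σ` with `σ ζ = ζ²`, and an equivariant endomorphism `φ` of `E(K̄)` acting by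
`(x, y) ↦ (ζ'²x, ζ'³y)` with `φ² + φ + 1 = 0`, the classes `τ_*(φ_* c)`, `φ_*(τ_* c)`, `τ_* c` sum to
zero — on cocycles `g ↦ τφQ + φτQ + τQ`, `Q = a(τ⁻¹gτ)`, and `τφQ = φφτQ = -φτQ - τQ` pointwise
(`pointsMap_cm_eq`). memo two §57.1 («σ is ℤ[ω]-semilinear»). [cite: GrossLMS1991, §5 (5.1)]
[cite: SilvermanAEC2009, Cor. III.10.2] -/
theorem conjH1Points_galH1Map_add (hτ : IsLiftOfAut σ τ) {ζ : K} (hσ : σ ζ = ζ ^ 2)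
    (φ : geomPoints (W.baseChange K) →+ geomPoints (W.baseChange K))
    (hφG : ∀ (g : Field.absoluteGaloisGroup K) (P : geomPoints (W.baseChange K)),
      φ (g • P) = g • φ P)
    (hφ : ∀ (x y : AlgebraicClosure K)
      (h : ((W.baseChange K).baseChange (AlgebraicClosure K)).toAffine.Nonsingular x y),
      ∃ h', φ (Affine.Point.some x y h) =
        Affine.Point.some (algebraMap K (AlgebraicClosure K) ζ ^ 2 * x)
          (algebraMap K (AlgebraicClosure K) ζ ^ 3 * y) h')
    (hrel : ∀ P, φ (φ P) + φ P + P = 0) (c : (W.baseChange K).galH1) :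
    hτ.conjH1Points W (galH1Map φ hφG c) + galH1Map φ hφG (hτ.conjH1Points W c) +
      hτ.conjH1Points W c = 0 := by
  -- pointwise: `τ (φ Q) + φ (τ Q) + τ Q = 0`
  have hψ : ∀ (x y : AlgebraicClosure K)
      (h : ((W.baseChange K).baseChange (AlgebraicClosure K)).toAffine.Nonsingular x y),
      ∃ h', hτ.pointsMap W (Affine.Point.some x y h) = Affine.Point.some (τ x) (τ y) h' :=
    fun x y h ↦ ⟨_, rfl⟩
  have hpt : ∀ Q : geomPoints (W.baseChange K),
      hτ.pointsMap W (φ Q) + φ (hτ.pointsMap W Q) + hτ.pointsMap W Q = 0 := by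
    intro Q
    rw [pointsMap_cm_eq W hτ hσ (hτ.pointsMap W) φ hψ hφ Q]
    exact hrel _
  obtain ⟨a, rfl⟩ := oneCocycleClass_surjective _ c
  rw [galH1Map_oneCocycleClass, conjH1Points_oneCocycleClass, conjH1Points_oneCocycleClass,
    galH1Map_oneCocycleClass, ← oneCocycleClass_add, ← oneCocycleClass_add]
  have h0 : contOneCocycles.pullback hτ.conjGalCMH
        (resHomOfEquivariant hτ.conjGalCMH (hτ.pointsMap W) (hτ.pointsMap_smul W))
        (contOneCocycles.push φ hφG a) +
      contOneCocycles.push φ hφG (contOneCocycles.pullback hτ.conjGalCMH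
        (resHomOfEquivariant hτ.conjGalCMH (hτ.pointsMap W) (hτ.pointsMap_smul W)) a) +
      contOneCocycles.pullback hτ.conjGalCMH
        (resHomOfEquivariant hτ.conjGalCMH (hτ.pointsMap W) (hτ.pointsMap_smul W)) a = 0 := by
    apply Subtype.ext
    ext g
    exact hpt (a.1 (hτ.conjGalCMH g))
  rw [h0]
  exact map_zero (oneCocycleClassₗ _)

end AntiCommutation

/-! ## §4 (WRAP-σ) + (WRAP-𝒪): the data `(M, w, σ)` of LEMMA D on `Ш(E/K)[2^∞]`; the SQUARE LAW -/

section LemmaDData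

open NumberField

variable {K : Type} [Field K] [NumberField K] (W : WeierstrassCurve ℚ)
variable {σ : K ≃ₐ[ℚ] K} {τ : AlgebraicClosure K ≃+* AlgebraicClosure K}

/-- Transport of (WRAP-𝒪) to any `K`-model EQUAL to a `j = 0` short model `⟨0, 0, 0, 0, B⟩` (e.g. the
base change `(⟨0, 0, 0, 0, B₀⟩/ℚ)_K`, `B = B₀`): the complex multiplication `[ζ]` as an endo-isogeny
acting by `(x, y) ↦ (ζ'²x, ζ'³y)` with `[ζ]² + [ζ] + 1 = 0` on `E(K̄)`
(`SylvesterTwoShaOmegaAction.exists_cm_shaMap_relation`, by `subst`).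
[cite: SilvermanAEC2009, Thm. III.10.1 and Cor. III.10.2] -/
theorem exists_cm_isogeny_of_eq {V : WeierstrassCurve K} {B ζ : K} (hV : V = ⟨0, 0, 0, 0, B⟩)
    (hζ : IsPrimitiveRoot ζ 3) :
    ∃ φ : Isogeny V V,
      (∀ (x y : AlgebraicClosure K)
        (h : (V.baseChange (AlgebraicClosure K)).toAffine.Nonsingular x y),
        ∃ h', φ (Affine.Point.some x y h) =
          Affine.Point.some (algebraMap K (AlgebraicClosure K) ζ ^ 2 * x)
            (algebraMap K (AlgebraicClosure K) ζ ^ 3 * y) h') ∧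
      ∀ P, φ (φ P) + φ P + P = 0 := by
  subst hV
  obtain ⟨φ, hφ, hrel, -⟩ := SylvesterTwoShaOmegaAction.exists_cm_shaMap_relation (B := B) hζ
  exact ⟨φ, hφ, hrel⟩

/-- **The data `(M, w, σ)` of LEMMA D on the TREE's `Ш(E/K)[2^∞]`.** `E = W/ℚ` with
`W_K = ⟨0, 0, 0, 0, B⟩` a `j = 0` short model (e.g. `W = cubeSumCurve p`), `K` a totally complex number
field with a primitive cube root `ζ` (e.g. `ℚ(ω)`), `σ ∈ Aut(K/ℚ)` an involution with `σ ζ = ζ²`, `τ` a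
lift. On `M := Ш(E/K)[2^∞]` (`AddCommGroup.primaryComponent` of the tree's `WeierstrassCurve.sha`)
there are `w` (`Ш([ζ])`, coercing to `H¹([ζ])`) and `s` (`τ_*` restricted, by `conjH1Points_mem_sha`)
with `w² + w + 1 = 0`, `s² = 1`, `s w = -s - w s`, and `3` bijective on `M` — ALL the hypotheses of
`SylvesterTwoUnramifiedDescent.descent_bijective` / `card_eq_card_invariants_sq` (LEMMA D ≡ LEMMA K0,
memo two §57.1). [cite: GrossLMS1991, §5 (5.1)] [cite: SilvermanAEC2009, Thm. III.10.1 and Cor. III.10.2] -/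
theorem exists_lemmaD_data (hK : ∀ v : InfinitePlace K, v.IsComplex) (hτ : IsLiftOfAut σ τ)
    (hσ2 : σ * σ = 1) {B ζ : K} (hW : W.baseChange K = ⟨0, 0, 0, 0, B⟩) (hζ : IsPrimitiveRoot ζ 3)
    (hσζ : σ ζ = ζ ^ 2) :
    ∃ (φ : Isogeny (W.baseChange K) (W.baseChange K))
      (w s : AddCommGroup.primaryComponent (W.baseChange K).sha 2 →+
        AddCommGroup.primaryComponent (W.baseChange K).sha 2),
      (∀ x, (((w x : AddCommGroup.primaryComponent (W.baseChange K).sha 2) :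
          (W.baseChange K).sha) : (W.baseChange K).galH1) =
        galH1Map φ.toAddMonoidHom φ.equivariant ((x : (W.baseChange K).sha) : (W.baseChange K).galH1)) ∧
      (∀ x, (((s x : AddCommGroup.primaryComponent (W.baseChange K).sha 2) :
          (W.baseChange K).sha) : (W.baseChange K).galH1) =
        hτ.conjH1Points W ((x : (W.baseChange K).sha) : (W.baseChange K).galH1)) ∧
      (∀ x, w (w x) + w x + x = 0) ∧ (∀ x, s (s x) = x) ∧ (∀ x, s (w x) = -(s x) - w (s x)) ∧
      Function.Bijective fun x : AddCommGroup.primaryComponent (W.baseChange K).sha 2 =>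
        (3 : ℤ) • x := by
  obtain ⟨φ, hφ, hrel⟩ := exists_cm_isogeny_of_eq (V := W.baseChange K) hW hζ
  -- `w` on `Ш` and on `Ш[2^∞]`
  have hwSha := SylvesterTwoShaOmegaAction.shaMap_shaMap_add_shaMap_add_self_eq_zero
    φ.toAddMonoidHom φ.equivariant φ.hasLocalPointsMaps_toAddMonoidHom hrel
  obtain ⟨w, hw⟩ := SylvesterTwoShaOmegaAction.exists_restrict_primaryComponent
    (shaMap φ.toAddMonoidHom φ.equivariant φ.hasLocalPointsMaps_toAddMonoidHom) 2
  -- `s` on `Ш` (stability) and on `Ш[2^∞]`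
  let sSha : (W.baseChange K).sha →+ (W.baseChange K).sha :=
    ((hτ.conjH1Points W).comp (W.baseChange K).sha.subtype).codRestrict _
      fun c ↦ conjH1Points_mem_sha W hK hτ c.2
  have hsSha : ∀ c : (W.baseChange K).sha, ((sSha c : (W.baseChange K).sha) : (W.baseChange K).galH1)
      = hτ.conjH1Points W c := fun _ ↦ rfl
  obtain ⟨s, hs⟩ := SylvesterTwoShaOmegaAction.exists_restrict_primaryComponent sSha 2
  refine ⟨φ, w, s, fun x ↦ ?_, fun x ↦ ?_, SylvesterTwoShaOmegaAction.restrict_relation hw hwSha,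
    fun x ↦ ?_, fun x ↦ ?_,
    SylvesterTwoUnramifiedDescent.three_zsmul_bijective_of_two_primary
      SylvesterTwoShaOmegaAction.exists_two_zpow_smul_eq_zero⟩
  · rw [hw, coe_shaMap_apply]
  · rw [hs, hsSha]
  · apply Subtype.ext
    apply Subtype.ext
    rw [hs, hsSha, hs, hsSha]
    exact conjH1Points_conjH1Points_of_mul_self W hσ2 hτ _
  · apply Subtype.ext
    apply Subtype.ext
    have e := conjH1Points_galH1Map_add W hτ hσζ φ.toAddMonoidHom φ.equivariant hφ hrel
      ((x : (W.baseChange K).sha) : (W.baseChange K).galH1)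
    rw [add_assoc, add_eq_zero_iff_eq_neg, neg_add, ← sub_eq_add_neg] at e
    rw [AddSubgroupClass.coe_sub, AddSubgroupClass.coe_sub, NegMemClass.coe_neg,
      NegMemClass.coe_neg, hs, hsSha, hw, coe_shaMap_apply, hw, coe_shaMap_apply, hs, hsSha, e]
    abel

/-- **THE SQUARE LAW for the genuine `Ш`** (LEMMA D applied), in the setting of `exists_lemmaD_data`:
the involution `s = τ_*` of `M = Ш(E/K)[2^∞]` satisfies `Nat.card M = (Nat.card (ker (s - id)))²`
(`SylvesterTwoUnramifiedDescent.card_eq_card_invariants_sq`; for infinite `M` both sides are Mathlib's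
junk `0`-reading, as stated there). For `E_p : x³ + y³ = p` over `ℚ(ω)` this is memo two §57.1's
«`#Ш(E_p/K)[2^∞] = (#Ш(E_p/K)[2^∞]^σ)²`»; the identification `M^{s} ↔ res Ш(E_p/ℚ)[2^∞]` is NOT
claimed. [cite: GrossLMS1991, §5 (5.1)] [cite: SilvermanAEC2009, Thm. III.10.1 and Cor. III.10.2] -/
theorem card_sha_two_primary_eq_card_invariants_sq (hK : ∀ v : InfinitePlace K, v.IsComplex)
    (hτ : IsLiftOfAut σ τ) (hσ2 : σ * σ = 1) {B ζ : K} (hW : W.baseChange K = ⟨0, 0, 0, 0, B⟩)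
    (hζ : IsPrimitiveRoot ζ 3) (hσζ : σ ζ = ζ ^ 2) :
    ∃ s : AddCommGroup.primaryComponent (W.baseChange K).sha 2 →+
        AddCommGroup.primaryComponent (W.baseChange K).sha 2,
      (∀ x, (((s x : AddCommGroup.primaryComponent (W.baseChange K).sha 2) :
          (W.baseChange K).sha) : (W.baseChange K).galH1) =
        hτ.conjH1Points W ((x : (W.baseChange K).sha) : (W.baseChange K).galH1)) ∧
      (∀ x, s (s x) = x) ∧
      Nat.card (AddCommGroup.primaryComponent (W.baseChange K).sha 2) =
        Nat.card (s - AddMonoidHom.id _).ker ^ 2 := by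
  obtain ⟨φ, w, s, -, hs, hw, hss, hsw, h3⟩ := exists_lemmaD_data W hK hτ hσ2 hW hζ hσζ
  exact ⟨s, hs, hss, SylvesterTwoUnramifiedDescent.card_eq_card_invariants_sq w s hw hss hsw h3⟩

end LemmaDData

end Summit.BirchSwinnertonDyer.BirchSwinnertonDyer.Theorems.SylvesterTwoShaConjugation

end
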